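import Mathlib
import HarnessLib

/-!
# ExpAlgebraicTranscendenceMeasure

Topic `Literature/NumberTheory/Transcendental`. Named literature fact(s) relocated by the gate from `Summits/Schanuel/Schanuel/Theorems/DiophantineDichotomyKhovanskiiApproxTypeExpFiniteType.lean`
(accept-time relocation of `[cite]`d propositions written inline in a Summits proposal; human ruling 2026-08-15).
Sources: Waldschmidt1978.

* `Literature.NumberTheory.Transcendental.Waldschmidt1978_cor_3_9`
-/

namespace Literature.NumberTheory.Transcendental

open Polynomial

/-- **Waldschmidt 1978, Corollary 3.9** (M. Waldschmidt, *Transcendence measures for exponentials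
and logarithms*, J. Austral. Math. Soc. (A) 25 (1978) 445–465, p. 455): for a non-zero algebraic
number `β`, "a transcendence measure for `e^β` is
`8 C₁₆(β) N² (Log H + Log N)(Log Log H + Log N)² (Log Log H + Log₊ Log N)⁻²`", i.e. (conventions
p. 445–446: degree `≤ N`, `N ≥ 1`; usual height `≤ H`, `H ≥ 16`; `Log₊ x = log max(1, x)`)
`log |P(e^β)| ≥ −C N² (log H + log N)(log log H + log N)² / (log log H + log max(1, log N))²` for
every non-zero `P ∈ ℤ[X]` of degree `≤ N` and height `≤ H`, with `C = 8 C₁₆(β) > 0` (explicit in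
print, p. 454; rendered existentially; the printed strict `>` is weakened to `≥`). NAMED FACT, not
proved here; users take `(h : Waldschmidt1978_cor_3_9)`.
[cite: Waldschmidt1978, Corollary 3.9] [file NumberTheory/Transcendental/ExpAlgebraicTranscendenceMeasure] -/
def Waldschmidt1978_cor_3_9 : Prop :=
  ∀ β : ℂ, IsAlgebraic ℚ β → β ≠ 0 → ∃ C : ℝ, 0 < C ∧
    ∀ (P : Polynomial ℤ) (N H : ℕ), P ≠ 0 → 1 ≤ N → P.natDegree ≤ N → 16 ≤ H →
      (∀ k, |P.coeff k| ≤ (H : ℤ)) →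
      Real.exp (-(C * (N : ℝ) ^ 2 * (Real.log H + Real.log N) *
          (Real.log (Real.log H) + Real.log N) ^ 2 /
          (Real.log (Real.log H) + Real.log (max 1 (Real.log N))) ^ 2)) ≤
        ‖Polynomial.aeval (Complex.exp β) P‖

end Literature.NumberTheory.Transcendental
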